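import Mathlib
import HarnessLib
import Literature.MathematicalPhysics.QuantumFieldTheory.ConstructiveQFTWave0
import Literature.MathematicalPhysics.QuantumLattice.AbelianFieldTensor
import Literature.MathematicalPhysics.QuantumLattice.AbelianMagneticFlux
import Literature.MathematicalPhysics.QuantumLattice.AbelianBianchiIdentity
import Summits.Ventures.LatticeQCDFlow.Scaling.TopologicalCollar
import Summits.Ventures.LatticeQCDFlow.Scaling.FluxSectorCollar
import Summits.Ventures.LatticeQCDFlow.Scaling.FluxSmallSteps
import Summits.Ventures.LatticeQCDFlow.Scaling.SliceTwistWitness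
import Summits.Ventures.LatticeQCDFlow.Scaling.RowFields
import Summits.Ventures.LatticeQCDFlow.Scaling.ThinSectorsConnected
import Summits.Ventures.LatticeQCDFlow.Scaling.TorusCochain
import Summits.Ventures.LatticeQCDFlow.Scaling.TorusPoincareLemma
import Summits.Ventures.LatticeQCDFlow.Scaling.MonopoleNumber
import Summits.Ventures.LatticeQCDFlow.Scaling.MonopoleSectors

/-!
# The monopole crystal: sharpness of the admissibility threshold for `ε`-sectors (C10 (d), `d = 3`)

HONEST FRAMING: exact (Metropolis-corrected) sampling algorithms for lattice gauge theory;
figures of merit are autocorrelation/cost numbers at stated couplings and volumes; no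
continuum-physics claim.

Venture `LatticeQCDFlow` (cell pub-lqcd), topic `Scaling`, FANOUT row 29 (theory2, gen-23), item 114
(after 113a/113b `Scaling/MonopoleNumber`, `Scaling/MonopoleSectors` and 112a/112b
`Scaling/TorusCochain`, `Scaling/TorusPoincareLemma`).  NEW WORK; nothing here is cited as a fact.
LITERATURE STATUS (honest): DeGrand–Toussaint monopoles (Phys. Rev. D 22 (1980) 2478) and Lüscher's
admissibility bound `|F| < π/3` [Luscher1999AbelianChiral, §2.2] are classical; that the bound is
sharp for the ABSENCE of monopoles is folklore (a single cube with six faces of angle `π/3` carries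
flux `2π`).  What is added: an explicit, kernel-checked configuration on the whole periodic lattice —
every plaquette angle EXACTLY `±π/3`, every cube charged `±1` in a rock-salt pattern, every flux zero
— and the consequence for the cell's `ε`-sectors: for `1 < ε ≤ 2` they are strictly finer than the
flux sectors, so the threshold `ε = 1` of item 113b (`mem_connectedComponentIn_thin_iff_of_le_one`)
cannot be raised.  Grade: an elementary explicit construction; no new theorem of physics.

THE CONSTRUCTION (`L` even, `d = 3`).  Let `χ(x) = (−1)^{x₀+x₁+x₂}` (`chi`), `cyc` the cyclic
orientation sign on index pairs (`+1` on `(0,1),(1,2),(2,0)`), `str` the carrier of the `(1,2)`-faces.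
The real `2`-cochain
  `B(x;μ,ν) = −(π/3)·χ(x)·cyc(μ,ν) + 2π·[x₀ odd]·χ(x)·str(μ,ν)`            (`crystalForm`)
("angles `∓π/3` on every plaquette plus one Dirac string of `2π` through the `(1,2)`-face of every
cube with odd first coordinate") is antisymmetric, CLOSED — on each cube the six angles contribute
`6·(π/3)·χ = 2πχ` and the two `(1,2)`-faces contribute `2π([x₀+1 odd]·(−χ) − [x₀ odd]·χ) = −2πχ`
(`cob_crystalForm`) — and has ZERO PERIODS, because `χ` alternates along every lattice line and `L`
is even (`period_crystalForm`).  By the real case of the Poincaré lemma of item 112b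
(`TorusCochain.exists_curl_eq` over `ℝ`) `B = curl a` for a real link field `a`
(`crystalPotential`), and THE MONOPOLE CRYSTAL is `crystal = exp(i a)`.  Its plaquettes are
`exp(−i(π/3)χ(x)cyc(μ,ν))` (`plaquetteHolonomy_crystal`; the strings are invisible after
exponentiation), so its field tensor is `−(π/3)χ·cyc` (`abelianFieldTensor_crystal`), every
plaquette is at chordal distance `≤ 2 sin(π/6) = 1` from `1` with equality on the `(0,1)`-plaquettes
(`crystal_mem_thinSet_iff : crystal ∈ ThinSet 3 L ε ↔ 1 < ε`), every cube carries monopole number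
`χ(x) = ±1` (`monopole_crystal`), and every flux `topCharge x₀ μ ν` vanishes (`topCharge_crystal`).

THE CONSEQUENCE (C10 (d) of the cell's THEORY-2 §4, in `d = 3`, every even `L ≥ 2`).  The vacuum `1`
is `ε`-thin with all monopole numbers and fluxes `0`; by the sector invariance of monopole numbers
(113a `monopole_eq_of_mem_connectedComponentIn`, `ε ≤ 2`) the crystal is NOT in the `ε`-sector of the
vacuum (`crystal_not_mem_connectedComponentIn_one`) although all its fluxes agree with the vacuum's:
`exists_thin_sameFlux_not_connected` (for `1 < ε ≤ 2` the `ε`-sector partition of `ThinSet 3 L ε` is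
strictly finer than the flux partition) and the closed statement `MonopoleThresholdSharp3` /
`monopoleThresholdSharp3`.  Sampling reading (no physics claim): above the admissibility threshold an
exact sampler whose proposals move continuously inside the `ε`-thin set must ALSO tunnel between
monopole sectors, not only between flux sectors.  Odd `L` and `d ≥ 4` (where the same crystal,
extended trivially in the extra directions, works) are not treated in this file.

No `sorry`, no new axioms, no `opaque`; standard axioms only.
-/

noncomputable section

namespace Summit.Ventures.LatticeQCDFlow.Theory2.Lattice.Flux.MonopoleSectors

open Metric Set Filter Topology Real Finset
open Literature.MathematicalPhysics.QuantumFieldTheory Literature.MathematicalPhysics.QuantumLattice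
open Summit.Ventures.LatticeQCDFlow.Theory2.Lattice.Flux.TorusCochain

variable {L : ℕ} [NeZero L]

/-! ## §1. Parity on an even torus -/

/-- Reduction modulo `2` of a coordinate (the volume `L` is even). [folklore] -/
def par (hL : 2 ∣ L) : ZMod L →+* ZMod 2 := ZMod.castHom hL (ZMod 2)

omit [NeZero L] in
/-- Adding one flips the parity. [folklore] -/
theorem par_add_one_eq_zero_iff (hL : 2 ∣ L) (t : ZMod L) : par hL (t + 1) = 0 ↔ par hL t ≠ 0 := by
  rw [map_add, map_one]
  rcases (by decide : ∀ a : ZMod 2, a = 0 ∨ a = 1) (par hL t) with h | h <;> rw [h] <;> decide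

/-- The staggered sign `χ(x) = (−1)^{x₀+x₁+x₂}` of a site (equivalently of the cube based at it).
[folklore] -/
def chi (hL : 2 ∣ L) (x : Site 3 L) : ℤ := if par hL (∑ j, x j) = 0 then 1 else -1

/-- The indicator of odd first coordinate. [folklore] -/
def oddInd (hL : 2 ∣ L) (t : ZMod L) : ℤ := if par hL t = 0 then 0 else 1

omit [NeZero L] in
/-- The coordinate sum increases by one under every shift. [folklore] -/
theorem sum_shift (x : Site 3 L) (μ : Fin 3) : ∑ j, (x.shift μ) j = ∑ j, x j + 1 := by
  simp [Site.shift, Finset.sum_add_distrib, Pi.single_apply]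

omit [NeZero L] in
/-- **The staggered sign alternates under every shift.** [folklore] -/
theorem chi_shift (hL : 2 ∣ L) (x : Site 3 L) (μ : Fin 3) : chi hL (x.shift μ) = -chi hL x := by
  unfold chi
  rw [sum_shift]
  by_cases h : par hL (∑ j, x j) = 0
  · rw [if_pos h, if_neg (fun h' => ((par_add_one_eq_zero_iff hL _).mp h') h)]
  · rw [if_neg h, if_pos ((par_add_one_eq_zero_iff hL _).mpr h), neg_neg]

omit [NeZero L] in
/-- `χ = ±1`. [folklore] -/
theorem chi_eq_or (hL : 2 ∣ L) (x : Site 3 L) : chi hL x = 1 ∨ chi hL x = -1 := by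
  unfold chi; split_ifs <;> simp

omit [NeZero L] in
/-- `χ ≠ 0`. [folklore] -/
theorem chi_ne_zero (hL : 2 ∣ L) (x : Site 3 L) : (chi hL x : ℝ) ≠ 0 := by
  rcases chi_eq_or hL x with h | h <;> rw [h] <;> norm_num

omit [NeZero L] in
/-- The odd indicator alternates: `[t+1 odd] = 1 − [t odd]`. [folklore] -/
theorem oddInd_add_one (hL : 2 ∣ L) (t : ZMod L) : oddInd hL (t + 1) = 1 - oddInd hL t := by
  unfold oddInd
  by_cases h : par hL t = 0
  · rw [if_pos h, if_neg (fun h' => ((par_add_one_eq_zero_iff hL t).mp h') h)]; ring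
  · rw [if_neg h, if_pos ((par_add_one_eq_zero_iff hL t).mpr h)]; ring

omit [NeZero L] in
/-- `[t odd] ∈ {0, 1}`. [folklore] -/
theorem oddInd_eq_or (hL : 2 ∣ L) (t : ZMod L) : oddInd hL t = 0 ∨ oddInd hL t = 1 := by
  unfold oddInd; split_ifs <;> simp

/-! ## §2. The crystal form: `∓π/3` on every plaquette plus Dirac strings -/

/-- The cyclic orientation sign on index pairs of `Fin 3`: `+1` on `(0,1), (1,2), (2,0)`, `−1` on the
reversed pairs, `0` on the diagonal. [folklore] -/
def cyc (μ ν : Fin 3) : ℤ := ![![0, 1, -1], ![-1, 0, 1], ![1, -1, 0]] μ ν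

/-- The Dirac-string carrier: `+1` on `(1,2)`, `−1` on `(2,1)`, `0` otherwise. [folklore] -/
def str (μ ν : Fin 3) : ℤ := ![![0, 0, 0], ![0, 0, 1], ![0, -1, 0]] μ ν

omit [NeZero L] in
/-- `cyc` is antisymmetric. [folklore] -/
theorem cyc_swap (μ ν : Fin 3) : cyc ν μ = -cyc μ ν := by
  fin_cases μ <;> fin_cases ν <;> simp [cyc]

omit [NeZero L] in
/-- `str` is antisymmetric. [folklore] -/
theorem str_swap (μ ν : Fin 3) : str ν μ = -str μ ν := by
  fin_cases μ <;> fin_cases ν <;> simp [str]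

omit [NeZero L] in
/-- `cyc ∈ {0, ±1}`. [folklore] -/
theorem abs_cyc_le (μ ν : Fin 3) : |(cyc μ ν : ℝ)| ≤ 1 := by
  fin_cases μ <;> fin_cases ν <;> simp [cyc]

/-- **The plaquette angles of the crystal**: `θ(x; μ,ν) = −(π/3)·χ(x)·cyc(μ,ν)` — every
non-degenerate plaquette carries angle `±π/3`, the sign staggered with the site parity and the cyclic
orientation. [folklore] -/
def crystalAngle (hL : 2 ∣ L) (x : Site 3 L) (μ ν : Fin 3) : ℝ := -(π / 3) * (chi hL x * cyc μ ν : ℤ)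

/-- **The Dirac strings of the crystal**: the integer `2`-cochain `[x₀ odd]·χ(x)·str(μ,ν)` (one unit
of `2π` through the `(1,2)`-face of every cube whose first coordinate is odd). [folklore] -/
def crystalString (hL : 2 ∣ L) (x : Site 3 L) (μ ν : Fin 3) : ℤ := oddInd hL (x 0) * chi hL x * str μ ν

/-- **The crystal form** `B = θ + 2π·s`: the real `2`-cochain to be realised as the curl of a link
field. [folklore] -/
def crystalForm (hL : 2 ∣ L) (x : Site 3 L) (μ ν : Fin 3) : ℝ :=
  crystalAngle hL x μ ν + 2 * π * (crystalString hL x μ ν : ℤ)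

omit [NeZero L] in
/-- The crystal angles are at most `π/3` in absolute value. [folklore] -/
theorem abs_crystalAngle_le (hL : 2 ∣ L) (x : Site 3 L) (μ ν : Fin 3) :
    |crystalAngle hL x μ ν| ≤ π / 3 := by
  rw [crystalAngle, abs_mul, abs_neg, abs_of_pos (by positivity : (0 : ℝ) < π / 3), Int.cast_mul,
    abs_mul]
  have h1 : |(chi hL x : ℝ)| = 1 := by rcases chi_eq_or hL x with h | h <;> rw [h] <;> norm_num
  rw [h1, one_mul]
  exact mul_le_of_le_one_right (by positivity) (abs_cyc_le μ ν)

omit [NeZero L] in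
/-- The crystal angles alternate under every shift. [folklore] -/
theorem crystalAngle_shift (hL : 2 ∣ L) (x : Site 3 L) (κ μ ν : Fin 3) :
    crystalAngle hL (x.shift κ) μ ν = -crystalAngle hL x μ ν := by
  simp only [crystalAngle, chi_shift]; push_cast; ring

omit [NeZero L] in
/-- The crystal angles are antisymmetric. [folklore] -/
theorem crystalAngle_swap (hL : 2 ∣ L) (x : Site 3 L) (μ ν : Fin 3) :
    crystalAngle hL x ν μ = -crystalAngle hL x μ ν := by
  simp only [crystalAngle]; rw [cyc_swap μ ν]; push_cast; ring

omit [NeZero L] in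
/-- The crystal form alternates under the shifts that fix the first coordinate. [folklore] -/
theorem crystalForm_shift_of_ne_zero (hL : 2 ∣ L) {κ : Fin 3} (hκ : κ ≠ 0) (x : Site 3 L)
    (μ ν : Fin 3) : crystalForm hL (x.shift κ) μ ν = -crystalForm hL x μ ν := by
  simp only [crystalForm, crystalAngle_shift, crystalString, chi_shift,
    shift_apply_of_ne x (Ne.symm hκ)]
  push_cast; ring

omit [NeZero L] in
/-- The crystal form is antisymmetric. [folklore] -/
theorem crystalForm_swap (hL : 2 ∣ L) (x : Site 3 L) (μ ν : Fin 3) :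
    crystalForm hL x ν μ = -crystalForm hL x μ ν := by
  rw [crystalForm, crystalForm, crystalAngle_swap hL x μ ν, crystalString, crystalString, str_swap μ ν]
  push_cast; ring

omit [NeZero L] in
/-- The crystal form has zero diagonal. [folklore] -/
theorem crystalForm_self (hL : 2 ∣ L) (x : Site 3 L) (μ : Fin 3) : crystalForm hL x μ μ = 0 := by
  have h := crystalForm_swap hL x μ μ
  linarith

omit [NeZero L] in
/-- **The crystal form is closed**: on every cube the `6 × (π/3)` of the angles is cancelled by the
`2π` of exactly one Dirac string. [folklore] -/
theorem cob_crystalForm (hL : 2 ∣ L) (x : Site 3 L) : cob (crystalForm hL) x 0 1 2 = 0 := by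
  simp only [cob, crystalForm, crystalAngle, crystalString, chi_shift, shift_apply_self,
    shift_apply_of_ne x (show (0 : Fin 3) ≠ 1 by decide),
    shift_apply_of_ne x (show (0 : Fin 3) ≠ 2 by decide), oddInd_add_one]
  simp [cyc, str]
  ring

/-- Alternating functions have vanishing circle sums. [folklore] -/
theorem lineSum_eq_zero_of_shift {d : ℕ} (κ : Fin d) (g : Site d L → ℝ)
    (hg : ∀ y, g (y.shift κ) = -g y) (x : Site d L) : lineSum κ g x = 0 := by
  have h := lineSum_shift_sub_self κ g x
  simp only [hg, lineSum, Finset.sum_sub_distrib, Finset.sum_neg_distrib] at h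
  simp only [lineSum]
  linarith

/-- **The crystal form has vanishing periods.** [folklore] -/
theorem period_crystalForm (hL : 2 ∣ L) (x : Site 3 L) {μ ν : Fin 3} (hμν : μ < ν) :
    period (crystalForm hL) x μ ν = 0 := by
  have hν : ν ≠ 0 := by
    rintro rfl; exact absurd (Fin.lt_def.mp hμν) (Nat.not_lt_zero _)
  have hin : lineSum ν (fun y => crystalForm hL y μ ν) = fun _ => (0 : ℝ) :=
    funext fun z => lineSum_eq_zero_of_shift ν _
      (fun y => crystalForm_shift_of_ne_zero hL hν y μ ν) z
  rw [period, hin, lineSum_zero_fun]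

/-- **The crystal form is the curl of a real link field** (the real Poincaré lemma of
`Scaling/TorusPoincareLemma`). [folklore] -/
theorem exists_curl_eq_crystalForm (hL : 2 ∣ L) :
    ∃ a : Edge 3 L → ℝ, ∀ x μ ν, curl a x μ ν = crystalForm hL x μ ν :=
  exists_curl_eq _ (fun x μ ν => crystalForm_swap hL x μ ν) (crystalForm_self hL)
    (cob_eq_zero_of_sorted _ (fun x μ ν => crystalForm_swap hL x μ ν) (crystalForm_self hL)
      (fun x ν ρ σ h1 h2 => by
        fin_cases ν <;> fin_cases ρ <;> fin_cases σ
        all_goals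
          first
          | exact absurd h1 (by decide)
          | exact absurd h2 (by decide)
          | exact cob_crystalForm hL x))
    (period_eq_zero_of_sorted _ (fun x μ ν => crystalForm_swap hL x μ ν) (crystalForm_self hL)
      fun x _ _ h => period_crystalForm hL x h)

/-! ## §3. The monopole crystal -/

/-- A real link field whose curl is the crystal form. [folklore] -/
def crystalPotential (hL : 2 ∣ L) : Edge 3 L → ℝ := Classical.choose (exists_curl_eq_crystalForm hL)

/-- The defining property of the crystal potential. [folklore] -/
theorem curl_crystalPotential (hL : 2 ∣ L) (x : Site 3 L) (μ ν : Fin 3) :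
    curl (crystalPotential hL) x μ ν = crystalForm hL x μ ν :=
  Classical.choose_spec (exists_curl_eq_crystalForm hL) x μ ν

/-- **The monopole crystal** on the even `3`-torus: the `U(1)` configuration `exp(i a)`, `a` the
crystal potential.  Every plaquette angle is `±π/3`, every cube carries a DeGrand–Toussaint monopole
of charge `χ(x) = ±1` (a rock-salt arrangement), and every flux vanishes. [folklore] -/
def crystal (hL : 2 ∣ L) : GaugeConfig 3 L Circle := fun e => Circle.exp (crystalPotential hL e)

/-- The plaquettes of the crystal. [folklore] -/
theorem plaquetteHolonomy_crystal (hL : 2 ∣ L) (x : Site 3 L) (μ ν : Fin 3) :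
    plaquetteHolonomy (crystal hL) x μ ν = Circle.exp (crystalAngle hL x μ ν) := by
  show plaquetteHolonomy (fun e => Circle.exp (crystalPotential hL e)) x μ ν = _
  rw [plaquetteHolonomy_exp, curl_crystalPotential, crystalForm]
  exact Circle.exp_eq_exp.mpr ⟨crystalString hL x μ ν, by ring⟩

/-- **The field tensor of the crystal is the crystal angle** (`|θ| ≤ π/3 < π`). [folklore] -/
theorem abelianFieldTensor_crystal (hL : 2 ∣ L) (x : Site 3 L) (μ ν : Fin 3) :
    abelianFieldTensor (crystal hL) x μ ν = crystalAngle hL x μ ν := by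
  have h := abs_le.mp (abs_crystalAngle_le hL x μ ν)
  exact abelianFieldTensor_eq_of_plaquette_eq_exp (plaquetteHolonomy_crystal hL x μ ν)
    (by linarith [Real.pi_pos]) (by linarith [Real.pi_pos])

/-- Every plaquette of the crystal is within chordal distance `1` of `1`. [folklore] -/
theorem dist_plaquetteHolonomy_crystal_le (hL : 2 ∣ L) (x : Site 3 L) (μ ν : Fin 3) :
    dist (plaquetteHolonomy (crystal hL) x μ ν) 1 ≤ 1 := by
  rw [plaquetteHolonomy_crystal]
  have h := dist_exp_one_le_of_abs_le (abs_crystalAngle_le hL x μ ν) (by linarith [Real.pi_pos])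
  rwa [show π / 3 / 2 = π / 6 by ring, Real.sin_pi_div_six, mul_one_div, div_self two_ne_zero] at h

/-- The `(0,1)` plaquette at the origin is at chordal distance EXACTLY `1`. [folklore] -/
theorem dist_plaquetteHolonomy_crystal_zero (hL : 2 ∣ L) :
    dist (plaquetteHolonomy (crystal hL) 0 0 1) 1 = 1 := by
  have key : ∀ s : ℝ, s = 1 ∨ s = -1 → |2 * Real.sin (-(π / 3) * s / 2)| = 1 := by
    rintro s (rfl | rfl)
    · rw [show -(π / 3) * (1 : ℝ) / 2 = -(π / 6) by ring, Real.sin_neg, Real.sin_pi_div_six]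
      norm_num
    · rw [show -(π / 3) * (-1 : ℝ) / 2 = π / 6 by ring, Real.sin_pi_div_six]; norm_num
  have hc : (cyc 0 1 : ℤ) = 1 := by simp [cyc]
  rw [plaquetteHolonomy_crystal, dist_exp_one_eq, crystalAngle, hc, mul_one]
  exact key _ (by rcases chi_eq_or hL 0 with h | h <;> simp [h])

/-- **The crystal is `ε`-thin exactly for `ε > 1`** (its maximal plaquette angle is `π/3`).
[folklore] -/
theorem crystal_mem_thinSet_iff (hL : 2 ∣ L) {ε : ℝ} : crystal hL ∈ ThinSet 3 L ε ↔ 1 < ε :=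
  ⟨fun h => by have h1 := h ⟨0, ⟨(0, 1), by decide⟩⟩; rwa [dist_plaquetteHolonomy_crystal_zero] at h1,
    fun h p => (dist_plaquetteHolonomy_crystal_le hL p.1 _ _).trans_lt h⟩

/-- **Every cube of the crystal carries a monopole of charge `χ(x) = ±1`.** [folklore] -/
theorem monopole_crystal (hL : 2 ∣ L) (x : Site 3 L) : monopole (crystal hL) x 0 1 2 = chi hL x := by
  have hF : abelianFieldTensor (crystal hL) = crystalAngle hL :=
    funext fun y => funext fun α => funext fun β => abelianFieldTensor_crystal hL y α β
  rw [monopole, hF]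
  simp only [cob, crystalAngle, chi_shift]
  simp [cyc]
  field_simp
  ring

/-- **Every flux of the crystal vanishes** (at every base point, in every index pair). [folklore] -/
theorem topCharge_crystal (hL : 2 ∣ L) (x₀ : Site 3 L) (μ ν : Fin 3) :
    topCharge x₀ μ ν (crystal hL) = 0 := by
  have hF : abelianFieldTensor (crystal hL) = crystalAngle hL :=
    funext fun y => funext fun α => funext fun β => abelianFieldTensor_crystal hL y α β
  have hp : period (crystalAngle hL) x₀ μ ν = 0 := by
    have hin : lineSum ν (fun y => crystalAngle hL y μ ν) = fun _ => (0 : ℝ) :=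
      funext fun z => lineSum_eq_zero_of_shift ν _ (fun y => crystalAngle_shift hL y ν μ ν) z
    rw [period, hin, lineSum_zero_fun]
  rw [topCharge, magneticFlux, hF, ← period_eq_sum, hp, zero_div]

/-! ## §4. Sharpness of the monopole threshold: C10 (d) in `d = 3` -/

omit [NeZero L] in
/-- The trivial configuration has no monopoles. [folklore] -/
theorem monopole_one {d : ℕ} (x : Site d L) (ν ρ σ : Fin d) :
    monopole (1 : GaugeConfig d L Circle) x ν ρ σ = 0 := by
  simp [monopole, cob, abelianFieldTensor, plaquetteHolonomy_one']

omit [NeZero L] in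
/-- The trivial configuration is `ε`-thin for every `ε > 0`. [folklore] -/
theorem one_mem_thinSet {d : ℕ} {ε : ℝ} (hε : 0 < ε) : (1 : GaugeConfig d L Circle) ∈ ThinSet d L ε :=
  fun p => by simp only [plaquetteHolonomy_one', dist_self]; exact hε

/-- **The crystal and the vacuum have the same fluxes but lie in different `ε`-sectors** for every
`ε ≤ 2` (monopole numbers `±1` versus `0` are sector invariants, item 113a). [folklore] -/
theorem crystal_not_mem_connectedComponentIn_one (hL : 2 ∣ L) {ε : ℝ} (hε : ε ≤ 2) :
    crystal hL ∉ connectedComponentIn (ThinSet 3 L ε) 1 := fun h => by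
  have h1 := monopole_eq_of_mem_connectedComponentIn hε h 0 0 1 2
  rw [monopole_crystal, monopole_one] at h1
  exact chi_ne_zero hL 0 h1

/-- **C10 (d), `d = 3`: for `1 < ε ≤ 2` the `ε`-sector partition is STRICTLY FINER than the flux
partition.**  On every even `3`-torus there are two `ε`-thin configurations with the same flux through
every coordinate plane (at every base point) lying in different connected components of the thin set;
so the threshold `ε = 1` of `mem_connectedComponentIn_thin_iff_of_le_one` (item 113b) is sharp.
[folklore] -/
theorem exists_thin_sameFlux_not_connected (hL : 2 ∣ L) {ε : ℝ} (h1 : 1 < ε) (h2 : ε ≤ 2) :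
    ∃ U U' : GaugeConfig 3 L Circle, U ∈ ThinSet 3 L ε ∧ U' ∈ ThinSet 3 L ε ∧
      (∀ (x₀ : Site 3 L) (μ ν : Fin 3), topCharge x₀ μ ν U = topCharge x₀ μ ν U') ∧
      (∃ x : Site 3 L, monopole U' x 0 1 2 ≠ monopole U x 0 1 2) ∧
      U' ∉ connectedComponentIn (ThinSet 3 L ε) U :=
  ⟨1, crystal hL, one_mem_thinSet (by linarith), (crystal_mem_thinSet_iff hL).mpr h1,
    fun x₀ μ ν => by rw [topCharge_one', topCharge_crystal],
    ⟨0, by rw [monopole_crystal, monopole_one]; exact chi_ne_zero hL 0⟩,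
    crystal_not_mem_connectedComponentIn_one hL h2⟩

/-- Conjecture C10 (d) of the cell's THEORY-2 §4 in `d = 3` (sharpness of the monopole threshold), as
a closed statement: for every even `L ≥ 2` and every `1 < ε ≤ 2` the trivial flux sector of the
`ε`-thin set is disconnected — it contains a configuration outside the `ε`-sector of the vacuum.
[folklore] -/
def MonopoleThresholdSharp3 : Prop :=
  ∀ (L : ℕ) [NeZero L], 2 ∣ L → ∀ ε : ℝ, 1 < ε → ε ≤ 2 →
    ∃ U : GaugeConfig 3 L Circle, U ∈ ThinSet 3 L ε ∧
      (∀ (x₀ : Site 3 L) (μ ν : Fin 3), topCharge x₀ μ ν U = 0) ∧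
      U ∉ connectedComponentIn (ThinSet 3 L ε) 1

/-- **C10 (d) holds in `d = 3`** (every even `L ≥ 2`). [folklore] -/
theorem monopoleThresholdSharp3 : MonopoleThresholdSharp3 :=
  fun _ _ hL _ h1 h2 => ⟨crystal hL, (crystal_mem_thinSet_iff hL).mpr h1, topCharge_crystal hL,
    crystal_not_mem_connectedComponentIn_one hL h2⟩

end Summit.Ventures.LatticeQCDFlow.Theory2.Lattice.Flux.MonopoleSectors

end
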